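import Mathlib
import HarnessLib
import Summits.CriticalPhenomena.PercolationContinuityZ3.Theorems.PercNearOneGluingNoHeavyLowerTailTwoCopyLadderAllGradesLemmaQId1
import Summits.CriticalPhenomena.PercolationContinuityZ3.Theorems.PercNearOneGluingNoHeavyLowerTailTwoCopyLadderAllGradesLemmaQId2
import Summits.CriticalPhenomena.PercolationContinuityZ3.Theorems.PercNearOneGluingNoHeavyLowerTailTwoCopyLadderAllGradesLemmaQId3
import Summits.CriticalPhenomena.PercolationContinuityZ3.Theorems.PercNearOneGluingNoHeavyLowerTailTwoCopyLadderAllGradesLemmaQId4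
import Summits.CriticalPhenomena.PercolationContinuityZ3.Theorems.PercNearOneGluingNoHeavyLowerTailTwoCopyLadderAllGradesLemmaQId5

/-!
# LEMMA Q — the symmetric double of every ladder side is nonnegative for `q ∈ [0,1]` (part 8 of 10)

Helper files for crux `stmt-CriticalPhenomena-4575` (new-inequality factory `prim-ineq-gen-1`, gen 20); memo
`run/shared/lean/prim/prim-ineq-gen-1/FINDING-28-lemma-Q-tower.md`.  Sequel to `…TwoCopyLadderAllGradesRung` (gen 19), which reduced the
real-`q` rung theorem for ALL ladders (`Bhat q X Y ≥ 0`: Rayleigh negative correlation of the apex edge `av` of `L_r + av` with every rung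
at every `0 < q < 1`) to LEMMA Q: `Qsym q X = Bhat q X X ≥ 0` on the orbit `Orb` of the q-moves (`rungStep`,
    `qpendU`, `qpendW`, `mergeUW`
from `triv`).  METHOD ("self-generated tower"): expanding `Qsym q (move_ρ X)` in powers of the new weight `ρ` produces quartic forms in
the five types; iterating,
    the LP closure over `q ∈ [0,1]` (multipliers and remainders in the Bernstein-type basis `qⁱ(1−q)ʲ`) terminates
with the 12 forms `Qsym, QU3, QU2, QU1, QU3W3, QU3S3, QU1S1` and the mirrors (`mir`,
    `u ↔ w`) of the five non-symmetric ones: every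
`ρ`-coefficient of every form under every move is a nonnegative combination of the 12 forms plus a polynomial that is manifestly
nonnegative for `0 ≤ q ≤ 1` and nonnegative entries (71 exact LP certificates, kit jobs j133358
    + j133934; every identity below is checked by
`ring`).  Hence all 12 forms are nonnegative along the orbit by one simultaneous induction (`goodL_of_orb`,
    last part) — LEMMA Q
(`Qsym_nonneg_of_orb`) — and, with `rung_allq_nonneg_of_Qsym` of gen 19,
    the unconditional real-`q` rung theorem `rung_allq_nonneg`.
NOT formalised: the identification of `Bhat`/`Orb` with the graph polynomials (memo FINDING-26 §1).  (This work,
    2026-08-21.)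
-/

namespace Summit.CriticalPhenomena.PercolationContinuityZ3.Theorems

namespace TwoCopyLadderAllGrades

open TwoCopyLadderCubic

variable {R : Type*} [CommRing R]

/-! ## LEMMA Q: positivity along the orbit -/

section Ordered

variable {S : Type*} [CommRing S] [LinearOrder S] [IsStrictOrderedRing S]

/-- `QU1_qpendW_n1_c0 ≥ 0`. [this work] -/
theorem QU1_qpendW_n1_c0_nonneg {q : S} {X : SVec S} (hq : 0 ≤ q) (hc : 0 ≤ X.c) (hp : 0 ≤ X.p) (hm : 0 ≤ X.m) (hd : 0 ≤ X.d) (hs : 0 ≤ X.s) :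
    0 ≤ QU1_qpendW_n1_c0 q X := by
  unfold QU1_qpendW_n1_c0; positivity

/-- `QU1_qpendW_n1_c1 ≥ 0`. [this work] -/
theorem QU1_qpendW_n1_c1_nonneg {q : S} {X : SVec S}  :
    0 ≤ QU1_qpendW_n1_c1 q X := by
  unfold QU1_qpendW_n1_c1; positivity

/-- `QU1_qpendW_n1 ≥ 0`. [this work] -/
theorem QU1_qpendW_n1_nonneg {q : S} {X : SVec S} (hq : 0 ≤ q) (hc : 0 ≤ X.c) (hp : 0 ≤ X.p) (hm : 0 ≤ X.m) (hd : 0 ≤ X.d) (hs : 0 ≤ X.s) :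
    0 ≤ QU1_qpendW_n1 q X := by
  have h0 : 0 ≤ QU1_qpendW_n1_c0 q X := QU1_qpendW_n1_c0_nonneg hq hc hp hm hd hs
  have h1 : 0 ≤ QU1_qpendW_n1_c1 q X := QU1_qpendW_n1_c1_nonneg 
  unfold QU1_qpendW_n1; positivity

/-- `QU1_rungStep_n2_c0 ≥ 0`. [this work] -/
theorem QU1_rungStep_n2_c0_nonneg {q : S} {X : SVec S} (hq : 0 ≤ q) (hq' : 0 ≤ 1 - q) (hc : 0 ≤ X.c) (hp : 0 ≤ X.p) (hm : 0 ≤ X.m) (hd : 0 ≤ X.d) (hs : 0 ≤ X.s) :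
    0 ≤ QU1_rungStep_n2_c0 q X := by
  unfold QU1_rungStep_n2_c0; positivity

/-- `QU1_rungStep_n2_c1 ≥ 0`. [this work] -/
theorem QU1_rungStep_n2_c1_nonneg {q : S} {X : SVec S} (hq : 0 ≤ q) (hq' : 0 ≤ 1 - q) (hc : 0 ≤ X.c) (hp : 0 ≤ X.p) (hm : 0 ≤ X.m) (hd : 0 ≤ X.d) (hs : 0 ≤ X.s) :
    0 ≤ QU1_rungStep_n2_c1 q X := by
  unfold QU1_rungStep_n2_c1; positivity

/-- `QU1_rungStep_n2 ≥ 0`. [this work] -/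
theorem QU1_rungStep_n2_nonneg {q : S} {X : SVec S} (hq : 0 ≤ q) (hq' : 0 ≤ 1 - q) (hc : 0 ≤ X.c) (hp : 0 ≤ X.p) (hm : 0 ≤ X.m) (hd : 0 ≤ X.d) (hs : 0 ≤ X.s) :
    0 ≤ QU1_rungStep_n2 q X := by
  have h0 : 0 ≤ QU1_rungStep_n2_c0 q X := QU1_rungStep_n2_c0_nonneg hq hq' hc hp hm hd hs
  have h1 : 0 ≤ QU1_rungStep_n2_c1 q X := QU1_rungStep_n2_c1_nonneg hq hq' hc hp hm hd hs
  unfold QU1_rungStep_n2; positivity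

/-- `QU3W3_qpendU_n3_c0 ≥ 0`. [this work] -/
theorem QU3W3_qpendU_n3_c0_nonneg {q : S} {X : SVec S} (hq : 0 ≤ q) (hc : 0 ≤ X.c) (hp : 0 ≤ X.p) (hm : 0 ≤ X.m) (hd : 0 ≤ X.d) (hs : 0 ≤ X.s) :
    0 ≤ QU3W3_qpendU_n3_c0 q X := by
  unfold QU3W3_qpendU_n3_c0; positivity

/-- `QU3W3_qpendU_n3_c1 ≥ 0`. [this work] -/
theorem QU3W3_qpendU_n3_c1_nonneg {q : S} {X : SVec S} (hq : 0 ≤ q) (hc : 0 ≤ X.c) (hp : 0 ≤ X.p) (hm : 0 ≤ X.m) (hd : 0 ≤ X.d) (hs : 0 ≤ X.s) :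
    0 ≤ QU3W3_qpendU_n3_c1 q X := by
  unfold QU3W3_qpendU_n3_c1; positivity

/-- `QU3W3_qpendU_n3 ≥ 0`. [this work] -/
theorem QU3W3_qpendU_n3_nonneg {q : S} {X : SVec S} (hq : 0 ≤ q) (hc : 0 ≤ X.c) (hp : 0 ≤ X.p) (hm : 0 ≤ X.m) (hd : 0 ≤ X.d) (hs : 0 ≤ X.s) :
    0 ≤ QU3W3_qpendU_n3 q X := by
  have h0 : 0 ≤ QU3W3_qpendU_n3_c0 q X := QU3W3_qpendU_n3_c0_nonneg hq hc hp hm hd hs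
  have h1 : 0 ≤ QU3W3_qpendU_n3_c1 q X := QU3W3_qpendU_n3_c1_nonneg hq hc hp hm hd hs
  unfold QU3W3_qpendU_n3; positivity

/-- `QU3W3_qpendU_n2_c0 ≥ 0`. [this work] -/
theorem QU3W3_qpendU_n2_c0_nonneg {q : S} {X : SVec S} (hq : 0 ≤ q) (hc : 0 ≤ X.c) (hp : 0 ≤ X.p) (hm : 0 ≤ X.m) (hd : 0 ≤ X.d) (hs : 0 ≤ X.s) :
    0 ≤ QU3W3_qpendU_n2_c0 q X := by
  unfold QU3W3_qpendU_n2_c0; positivity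

/-- `QU3W3_qpendU_n2_c1 ≥ 0`. [this work] -/
theorem QU3W3_qpendU_n2_c1_nonneg {q : S} {X : SVec S} (hq : 0 ≤ q) (hc : 0 ≤ X.c) (hp : 0 ≤ X.p) (hm : 0 ≤ X.m) (hd : 0 ≤ X.d) (hs : 0 ≤ X.s) :
    0 ≤ QU3W3_qpendU_n2_c1 q X := by
  unfold QU3W3_qpendU_n2_c1; positivity

/-- `QU3W3_qpendU_n2 ≥ 0`. [this work] -/
theorem QU3W3_qpendU_n2_nonneg {q : S} {X : SVec S} (hq : 0 ≤ q) (hc : 0 ≤ X.c) (hp : 0 ≤ X.p) (hm : 0 ≤ X.m) (hd : 0 ≤ X.d) (hs : 0 ≤ X.s) :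
    0 ≤ QU3W3_qpendU_n2 q X := by
  have h0 : 0 ≤ QU3W3_qpendU_n2_c0 q X := QU3W3_qpendU_n2_c0_nonneg hq hc hp hm hd hs
  have h1 : 0 ≤ QU3W3_qpendU_n2_c1 q X := QU3W3_qpendU_n2_c1_nonneg hq hc hp hm hd hs
  unfold QU3W3_qpendU_n2; positivity

/-- `QU3W3_qpendU_n1_c0 ≥ 0`. [this work] -/
theorem QU3W3_qpendU_n1_c0_nonneg {q : S} {X : SVec S} (hq : 0 ≤ q) (hc : 0 ≤ X.c) (hp : 0 ≤ X.p) (hm : 0 ≤ X.m) (hd : 0 ≤ X.d) (hs : 0 ≤ X.s) :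
    0 ≤ QU3W3_qpendU_n1_c0 q X := by
  unfold QU3W3_qpendU_n1_c0; positivity

/-- `QU3W3_qpendU_n1_c1 ≥ 0`. [this work] -/
theorem QU3W3_qpendU_n1_c1_nonneg {q : S} {X : SVec S} (hq : 0 ≤ q) (hc : 0 ≤ X.c) (hp : 0 ≤ X.p) (hm : 0 ≤ X.m) (hd : 0 ≤ X.d) (hs : 0 ≤ X.s) :
    0 ≤ QU3W3_qpendU_n1_c1 q X := by
  unfold QU3W3_qpendU_n1_c1; positivity

/-- `QU3W3_qpendU_n1 ≥ 0`. [this work] -/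
theorem QU3W3_qpendU_n1_nonneg {q : S} {X : SVec S} (hq : 0 ≤ q) (hc : 0 ≤ X.c) (hp : 0 ≤ X.p) (hm : 0 ≤ X.m) (hd : 0 ≤ X.d) (hs : 0 ≤ X.s) :
    0 ≤ QU3W3_qpendU_n1 q X := by
  have h0 : 0 ≤ QU3W3_qpendU_n1_c0 q X := QU3W3_qpendU_n1_c0_nonneg hq hc hp hm hd hs
  have h1 : 0 ≤ QU3W3_qpendU_n1_c1 q X := QU3W3_qpendU_n1_c1_nonneg hq hc hp hm hd hs
  unfold QU3W3_qpendU_n1; positivity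

/-- `QU3W3_rungStep_n4_c0 ≥ 0`. [this work] -/
theorem QU3W3_rungStep_n4_c0_nonneg {q : S} {X : SVec S} (hq : 0 ≤ q) (hc : 0 ≤ X.c) (hp : 0 ≤ X.p) (hm : 0 ≤ X.m) (hd : 0 ≤ X.d) (hs : 0 ≤ X.s) :
    0 ≤ QU3W3_rungStep_n4_c0 q X := by
  unfold QU3W3_rungStep_n4_c0; positivity

/-- `QU3W3_rungStep_n4_c1 ≥ 0`. [this work] -/
theorem QU3W3_rungStep_n4_c1_nonneg {q : S} {X : SVec S} (hc : 0 ≤ X.c) (hp : 0 ≤ X.p) (hm : 0 ≤ X.m) :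
    0 ≤ QU3W3_rungStep_n4_c1 q X := by
  unfold QU3W3_rungStep_n4_c1; positivity

/-- `QU3W3_rungStep_n4 ≥ 0`. [this work] -/
theorem QU3W3_rungStep_n4_nonneg {q : S} {X : SVec S} (hq : 0 ≤ q) (hc : 0 ≤ X.c) (hp : 0 ≤ X.p) (hm : 0 ≤ X.m) (hd : 0 ≤ X.d) (hs : 0 ≤ X.s) :
    0 ≤ QU3W3_rungStep_n4 q X := by
  have h0 : 0 ≤ QU3W3_rungStep_n4_c0 q X := QU3W3_rungStep_n4_c0_nonneg hq hc hp hm hd hs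
  have h1 : 0 ≤ QU3W3_rungStep_n4_c1 q X := QU3W3_rungStep_n4_c1_nonneg hc hp hm
  unfold QU3W3_rungStep_n4; positivity

/-- `QU3S3_qpendU_n3_c0 ≥ 0`. [this work] -/
theorem QU3S3_qpendU_n3_c0_nonneg {q : S} {X : SVec S} (hq : 0 ≤ q) (hq' : 0 ≤ 1 - q) (hc : 0 ≤ X.c) (hp : 0 ≤ X.p) (hm : 0 ≤ X.m) (hd : 0 ≤ X.d) (hs : 0 ≤ X.s) :
    0 ≤ QU3S3_qpendU_n3_c0 q X := by
  unfold QU3S3_qpendU_n3_c0; positivity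

/-- `QU3S3_qpendU_n3_c1 ≥ 0`. [this work] -/
theorem QU3S3_qpendU_n3_c1_nonneg {q : S} {X : SVec S} (hq : 0 ≤ q) (hq' : 0 ≤ 1 - q) :
    0 ≤ QU3S3_qpendU_n3_c1 q X := by
  unfold QU3S3_qpendU_n3_c1; positivity

/-- `QU3S3_qpendU_n3 ≥ 0`. [this work] -/
theorem QU3S3_qpendU_n3_nonneg {q : S} {X : SVec S} (hq : 0 ≤ q) (hq' : 0 ≤ 1 - q) (hc : 0 ≤ X.c) (hp : 0 ≤ X.p) (hm : 0 ≤ X.m) (hd : 0 ≤ X.d) (hs : 0 ≤ X.s) :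
    0 ≤ QU3S3_qpendU_n3 q X := by
  have h0 : 0 ≤ QU3S3_qpendU_n3_c0 q X := QU3S3_qpendU_n3_c0_nonneg hq hq' hc hp hm hd hs
  have h1 : 0 ≤ QU3S3_qpendU_n3_c1 q X := QU3S3_qpendU_n3_c1_nonneg hq hq'
  unfold QU3S3_qpendU_n3; positivity

/-- `QU3S3_qpendW_n2_c0 ≥ 0`. [this work] -/
theorem QU3S3_qpendW_n2_c0_nonneg {q : S} {X : SVec S} (hq : 0 ≤ q) (hc : 0 ≤ X.c) (hp : 0 ≤ X.p) (hm : 0 ≤ X.m) (hd : 0 ≤ X.d) (hs : 0 ≤ X.s) :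
    0 ≤ QU3S3_qpendW_n2_c0 q X := by
  unfold QU3S3_qpendW_n2_c0; positivity

/-- `QU3S3_qpendW_n2_c1 ≥ 0`. [this work] -/
theorem QU3S3_qpendW_n2_c1_nonneg {q : S} {X : SVec S} (hq : 0 ≤ q) (hc : 0 ≤ X.c) (hp : 0 ≤ X.p) (hm : 0 ≤ X.m) (hd : 0 ≤ X.d) (hs : 0 ≤ X.s) :
    0 ≤ QU3S3_qpendW_n2_c1 q X := by
  unfold QU3S3_qpendW_n2_c1; positivity

/-- `QU3S3_qpendW_n2 ≥ 0`. [this work] -/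
theorem QU3S3_qpendW_n2_nonneg {q : S} {X : SVec S} (hq : 0 ≤ q) (hc : 0 ≤ X.c) (hp : 0 ≤ X.p) (hm : 0 ≤ X.m) (hd : 0 ≤ X.d) (hs : 0 ≤ X.s) :
    0 ≤ QU3S3_qpendW_n2 q X := by
  have h0 : 0 ≤ QU3S3_qpendW_n2_c0 q X := QU3S3_qpendW_n2_c0_nonneg hq hc hp hm hd hs
  have h1 : 0 ≤ QU3S3_qpendW_n2_c1 q X := QU3S3_qpendW_n2_c1_nonneg hq hc hp hm hd hs
  unfold QU3S3_qpendW_n2; positivity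

/-- `QU3S3_qpendW_n1_c0 ≥ 0`. [this work] -/
theorem QU3S3_qpendW_n1_c0_nonneg {q : S} {X : SVec S} (hq : 0 ≤ q) (hc : 0 ≤ X.c) (hp : 0 ≤ X.p) (hm : 0 ≤ X.m) (hd : 0 ≤ X.d) (hs : 0 ≤ X.s) :
    0 ≤ QU3S3_qpendW_n1_c0 q X := by
  unfold QU3S3_qpendW_n1_c0; positivity

/-- `QU3S3_qpendW_n1_c1 ≥ 0`. [this work] -/
theorem QU3S3_qpendW_n1_c1_nonneg {q : S} {X : SVec S} (hq : 0 ≤ q) (hc : 0 ≤ X.c) (hp : 0 ≤ X.p) (hm : 0 ≤ X.m) (hd : 0 ≤ X.d) (hs : 0 ≤ X.s) :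
    0 ≤ QU3S3_qpendW_n1_c1 q X := by
  unfold QU3S3_qpendW_n1_c1; positivity

/-- `QU3S3_qpendW_n1 ≥ 0`. [this work] -/
theorem QU3S3_qpendW_n1_nonneg {q : S} {X : SVec S} (hq : 0 ≤ q) (hc : 0 ≤ X.c) (hp : 0 ≤ X.p) (hm : 0 ≤ X.m) (hd : 0 ≤ X.d) (hs : 0 ≤ X.s) :
    0 ≤ QU3S3_qpendW_n1 q X := by
  have h0 : 0 ≤ QU3S3_qpendW_n1_c0 q X := QU3S3_qpendW_n1_c0_nonneg hq hc hp hm hd hs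
  have h1 : 0 ≤ QU3S3_qpendW_n1_c1 q X := QU3S3_qpendW_n1_c1_nonneg hq hc hp hm hd hs
  unfold QU3S3_qpendW_n1; positivity

/-- `QU3S3_qpendU_n2 ≥ 0`. [this work] -/
theorem QU3S3_qpendU_n2_nonneg {q : S} {X : SVec S} (hq : 0 ≤ q) (hq' : 0 ≤ 1 - q) (hc : 0 ≤ X.c) (hp : 0 ≤ X.p) (hm : 0 ≤ X.m) (hd : 0 ≤ X.d) (hs : 0 ≤ X.s) :
    0 ≤ QU3S3_qpendU_n2 q X := by
  unfold QU3S3_qpendU_n2; positivity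

/-- `QU3S3_qpendW_n0 ≥ 0`. [this work] -/
theorem QU3S3_qpendW_n0_nonneg {q : S} {X : SVec S} (hq : 0 ≤ q) (hc : 0 ≤ X.c) (hp : 0 ≤ X.p) (hm : 0 ≤ X.m) (hd : 0 ≤ X.d) (hs : 0 ≤ X.s) :
    0 ≤ QU3S3_qpendW_n0 q X := by
  unfold QU3S3_qpendW_n0; positivity

/-- `QU1S1_qpendW_n0 ≥ 0`. [this work] -/
theorem QU1S1_qpendW_n0_nonneg {q : S} {X : SVec S} (hq : 0 ≤ q) (hc : 0 ≤ X.c) (hp : 0 ≤ X.p) (hm : 0 ≤ X.m) (hd : 0 ≤ X.d) (hs : 0 ≤ X.s) :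
    0 ≤ QU1S1_qpendW_n0 q X := by
  unfold QU1S1_qpendW_n0; positivity

/-- `QU1S1_rungStep_n2 ≥ 0`. [this work] -/
theorem QU1S1_rungStep_n2_nonneg {q : S} {X : SVec S} (hq : 0 ≤ q) (hq' : 0 ≤ 1 - q) (hc : 0 ≤ X.c) (hp : 0 ≤ X.p) (hm : 0 ≤ X.m) (hd : 0 ≤ X.d) (hs : 0 ≤ X.s) :
    0 ≤ QU1S1_rungStep_n2 q X := by
  unfold QU1S1_rungStep_n2; positivity

/-- `QU1S1_rungStep_n1 ≥ 0`. [this work] -/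
theorem QU1S1_rungStep_n1_nonneg {q : S} {X : SVec S} (hq : 0 ≤ q) (hq' : 0 ≤ 1 - q) (hc : 0 ≤ X.c) (hp : 0 ≤ X.p) (hm : 0 ≤ X.m) (hd : 0 ≤ X.d) (hs : 0 ≤ X.s) :
    0 ≤ QU1S1_rungStep_n1 q X := by
  unfold QU1S1_rungStep_n1; positivity

end Ordered

end TwoCopyLadderAllGrades

end Summit.CriticalPhenomena.PercolationContinuityZ3.Theorems
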